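import Literature.NumberTheory.GaloisRepresentations.InertiaCohomologyInvariantsBound
import Literature.NumberTheory.GaloisRepresentations.LocalDualityTheorem
import HarnessLib

/-!
# `#H¹(I_F, A)[n] ≤ #A^{I_F}[n]` for an `n`-divisible discrete module, `n` prime to the residue
# characteristic (theorems only)

Topic `NumberTheory/GaloisRepresentations`; namespace `Literature.NumberTheory.GaloisRepresentations`.
THEOREMS ONLY (no definition, no named fact; D-0026). Sequel of `InertiaCohomologyInvariantsBound`
(`#H¹(I_F, B) ≤ #B^{I_F}` for FINITE `B`).

Let `F` be a non-archimedean local field, `I_F = absInertia F`, and `A` a discrete `Γ_F`-module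
(possibly infinite, e.g. `E[p^∞]`) on which multiplication by `n` is SURJECTIVE and whose
`n`-torsion `A[n]` is finite, `n` prime to the residue characteristic. From the cohomology sequence
of `0 → A[n] → A →(n) A → 0` over `I_F` (exactness at `H¹(I_F, A)`:
`ContinuousCohomologyConnecting.IsSES.exists_map_one_eq_of_map_one_eq_zero`; `H¹(n) = n`:
`cohomologyMap_one_eq_nsmul`) the `n`-torsion of `H¹(I_F, A)` is the image of `H¹(I_F, A[n])`, so

* `natCard_torsionBy_continuousCohomology_one_absInertia_le` —
  **`#H¹(I_F, A)[n] ≤ #H¹(I_F, A[n]) ≤ #(A[n])^{I_F}`**.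

Applied to `A = E[p^∞]` and `n = p^k` at a place `v ∤ p`: `#H¹(I_v, E[p^∞])[p^k] ≤ #E[p^k]^{I_v}`,
i.e. the `ℤ_p`-corank of `H¹(I_v, E[p^∞])` is at most that of `E[p^∞]^{I_v}` — the input of
Greenberg–Vatsal's §2 Prop. (2.4) (`corank 𝓗_ℓ(ℚ_∞) = s_ℓ d_ℓ`) on the inertia side (cell
`b2b-bsdres`; Greenberg, Adv. Stud. Pure Math. 17 (1989), Prop. 2).

## References

* [SerreLocalFields1979] J.-P. Serre, *Local Fields* (1979), Ch. IV §2, Ch. XIII §1.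
* [MilneADT2006] J. S. Milne, *Arithmetic Duality Theorems* (2006), I §2 Lemma 2.9, Thm. 2.8.
* [SerreGaloisCohomology1997] J.-P. Serre, *Galois Cohomology* (1997), I §2.2 (the cohomology
  sequence).
-/

noncomputable section

open CategoryTheory Function
open scoped Pointwise Valued
open Field ValuativeRel

universe u

namespace Literature.NumberTheory.GaloisRepresentations

open _root_.TopRep _root_.ContRepresentation _root_.ContinuousCohomology _root_.Topology _root_.Filter
open GaloisRepresentations.IsNonarchimedeanLocalField

section Local

variable (F : Type u) [Field F] [ValuativeRel F] [TopologicalSpace F] [IsNonarchimedeanLocalField F]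

variable {A : Type u} [AddCommGroup A] [TopologicalSpace A] [DiscreteTopology A]

/-- A finite abelian group of exponent dividing `n`, with `n` prime to `ℓ`, has order prime to `ℓ`
(Cauchy). [folklore] -/
private theorem natCard_coprime_of_nsmul_eq_zero {B : Type*} [AddCommGroup B] [Finite B]
    {n ℓ : ℕ} (hℓ : ℓ.Prime) (hn : n.Coprime ℓ) (hB : ∀ b : B, n • b = 0) :
    (Nat.card B).Coprime ℓ := by
  rw [Nat.Coprime, Nat.gcd_comm]
  refine (Nat.coprime_of_dvd fun q hq hqℓ hqB => ?_)
  have hq' : q = ℓ := (Nat.prime_dvd_prime_iff_eq hq hℓ).mp hqℓ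
  subst hq'
  haveI : Fact q.Prime := ⟨hq⟩
  obtain ⟨b, hb⟩ := exists_prime_addOrderOf_dvd_card' (G := B) q hqB
  have hdvd : q ∣ n := by
    rw [← hb]
    exact addOrderOf_dvd_of_nsmul_eq_zero (hB b)
  have h1 : q ∣ Nat.gcd n q := Nat.dvd_gcd hdvd dvd_rfl
  rw [hn] at h1
  exact hq.one_lt.ne' (Nat.dvd_one.mp h1)

/-- **`#H¹(I_F, A)[n] ≤ #(A[n])^{I_F}`** for a discrete `Γ_F`-module `A` on which multiplication by
`n` is surjective, `A[n]` finite, `n` prime to the residue characteristic of `F`. The `n`-torsion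
of `H¹(I_F, A)` is the image of `H¹(I_F, A[n])` (cohomology sequence of
`0 → A[n] → A →(n) A → 0`, Serre *CG* I §2.2), and `#H¹(I_F, A[n]) ≤ #A[n]^{I_F}`
(`natCard_continuousCohomology_one_absInertia_le_natCard_invariants`: Serre *Local Fields* IV §2,
XIII §1; Milne *ADT* I §2). In corank form this is the inertia half of Greenberg's
`H¹(K_∞, A) ≅ A*(K_∞)^` (Adv. Stud. Pure Math. 17 (1989), Prop. 2) as used by Greenberg–Vatsal,
Invent. Math. 142 (2000), §2 Prop. (2.4).
[cite: SerreLocalFields1979, Ch. IV §2 Cor. 1, Cor. 3 of Prop. 7 and Ch. XIII §1 Prop. 1]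
[cite: SerreGaloisCohomology1997, I §2.2] [cite: MilneADT2006, I §2 Lemma 2.9] -/
theorem natCard_torsionBy_continuousCohomology_one_absInertia_le
    (ρ : ContinuousRep (absoluteGaloisGroup F) ℤ A) {n : ℕ} (hn : n.Coprime (ringChar 𝓀[F]))
    (hdiv : ∀ a : A, ∃ b : A, n • b = a)
    [Finite (Submodule.torsionBy ℤ A (n : ℤ))] :
    Nat.card (Submodule.torsionBy ℤ
        (continuousCohomology 1 ((ρ.restrict (subgroupIncl (absInertia F))).toTopRep)) (n : ℤ)) ≤
      Nat.card {a : Submodule.torsionBy ℤ A (n : ℤ) //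
        ∀ σ : absoluteGaloisGroup F, σ ∈ absInertia F → ρ σ (a : A) = a} := by
  classical
  haveI : CompactSpace (absoluteGaloisGroup F) := absoluteGaloisGroup_compactSpace F
  have hIcl : IsClosed (absInertia F : Set (absoluteGaloisGroup F)) := isClosed_absInertia_holds F
  haveI : CompactSpace (absInertia F) := isCompact_iff_compactSpace.mp hIcl.isCompact
  -- the restricted representations
  set ρI : ContinuousRep (absInertia F) ℤ A := ρ.restrict (subgroupIncl (absInertia F)) with hρI
  -- Step 1: `#H¹(I_F, A[n]) ≤ #A[n]^{I_F}` (finite coefficients)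
  have hB : (Nat.card (Submodule.torsionBy ℤ A (n : ℤ))).Coprime (ringChar 𝓀[F]) :=
    natCard_coprime_of_nsmul_eq_zero (ringChar_residueField_prime (F := F)) hn fun b =>
      Subtype.ext (by
        rw [AddSubmonoidClass.coe_nsmul, ZeroMemClass.coe_zero]
        exact (ContinuousRep.mem_torsionBy_nsmul_iff n).1 b.2)
  have hfin := natCard_continuousCohomology_one_absInertia_le_natCard_invariants F (ρ.torsionRep n) hB
  have hfinite := (natCard_continuousCohomology_one_absInertia_le F (ρ.torsionRep n) hB).1
  -- the two restricted torsion representations agree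
  have hrep : (ρ.torsionRep n).restrict (subgroupIncl (absInertia F)) = ρI.torsionRep n := rfl
  rw [hrep] at hfin hfinite
  haveI := hfinite
  have hlast : Nat.card {b : Submodule.torsionBy ℤ A (n : ℤ) //
        ∀ σ : absoluteGaloisGroup F, σ ∈ absInertia F → (ρ.torsionRep n) σ b = b} =
      Nat.card {a : Submodule.torsionBy ℤ A (n : ℤ) //
        ∀ σ : absoluteGaloisGroup F, σ ∈ absInertia F → ρ σ (a : A) = a} :=
    Nat.card_congr (Equiv.subtypeEquivRight fun b => forall₂_congr fun σ _ => by
      rw [Subtype.ext_iff]; rfl)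
  -- Step 2: the short exact sequence `0 → A[n] → A →(n) A → 0` over `I_F`
  let g : ρI.toTopRep ⟶ ρI.toTopRep :=
    TopRep.ofHom
      { toLinearMap :=
          { toFun := fun a => n • a
            map_add' := fun a b => nsmul_add a b n
            map_smul' := fun c a => by
              change n • (c • a) = c • (n • a)
              exact smul_comm n c a }
        cont := continuous_of_discreteTopology
        isIntertwining' := fun σ => by
          refine ContinuousLinearMap.ext fun a => ?_
          change n • ρI.toTopRep.ρ σ a = ρI σ (n • a)
          rw [ContinuousRep.toTopRep_ρ_apply, map_nsmul] }
  have hg : ∀ a : A, g.hom a = n • a := fun _ => rfl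
  have hSES : IsSES (ρI.torsionIncl n) g :=
    { comp_eq_zero := by
        ext a
        change n • ((a : Submodule.torsionBy ℤ A (n : ℤ)) : A) = 0
        exact (ContinuousRep.mem_torsionBy_nsmul_iff n).1 a.2
      injective := Subtype.val_injective
      exact_mid := fun y hy => ⟨⟨y, (ContinuousRep.mem_torsionBy_nsmul_iff n).2 hy⟩, rfl⟩
      surjective := fun a => hdiv a }
  -- Step 3: every `n`-torsion class of `H¹(I_F, A)` comes from `H¹(I_F, A[n])`
  have himage : ∀ x : Submodule.torsionBy ℤ (continuousCohomology 1 ρI.toTopRep) (n : ℤ),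
      ∃ y : continuousCohomology 1 (ρI.torsionRep n).toTopRep,
        cohomologyMap (ρI.torsionIncl n) 1 y = (x : continuousCohomology 1 ρI.toTopRep) := by
    intro x
    refine hSES.exists_map_one_eq_of_map_one_eq_zero _ ?_
    rw [cohomologyMap_one_eq_nsmul ρI g n hg]
    have := x.2
    rw [Submodule.mem_torsionBy_iff, Nat.cast_smul_eq_nsmul] at this
    exact this
  choose lift hlift using himage
  have hinj : Injective lift := fun x y hxy => by
    apply Subtype.ext
    rw [← hlift x, ← hlift y, hxy]
  calc Nat.card (Submodule.torsionBy ℤ (continuousCohomology 1 ρI.toTopRep) (n : ℤ))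
      ≤ Nat.card (continuousCohomology 1 (ρI.torsionRep n).toTopRep) :=
        Nat.card_le_card_of_injective lift hinj
    _ ≤ _ := hfin
    _ = _ := hlast

/-- **`H¹(I_F, A)[n]` is finite** under the hypotheses of
`natCard_torsionBy_continuousCohomology_one_absInertia_le` (`A` discrete, `n`-divisible, `A[n]`
finite, `n` prime to the residue characteristic): the `n`-torsion of `H¹(I_F, A)` injects into the
finite group `H¹(I_F, A[n])` (same cohomology sequence; Serre *CG* I §2.2; Milne *ADT* I Lemma 2.9
for the finiteness of `H¹(I_F, A[n])`). Recorded separately because `Nat.card` inequalities do not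
by themselves carry finiteness.
[cite: SerreGaloisCohomology1997, I §2.2] [cite: MilneADT2006, I §2 Lemma 2.9] -/
theorem finite_torsionBy_continuousCohomology_one_absInertia
    (ρ : ContinuousRep (absoluteGaloisGroup F) ℤ A) {n : ℕ} (hn : n.Coprime (ringChar 𝓀[F]))
    (hdiv : ∀ a : A, ∃ b : A, n • b = a)
    [Finite (Submodule.torsionBy ℤ A (n : ℤ))] :
    Finite (Submodule.torsionBy ℤ
        (continuousCohomology 1 ((ρ.restrict (subgroupIncl (absInertia F))).toTopRep)) (n : ℤ)) := by
  classical
  haveI : CompactSpace (absoluteGaloisGroup F) := absoluteGaloisGroup_compactSpace F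
  have hIcl : IsClosed (absInertia F : Set (absoluteGaloisGroup F)) := isClosed_absInertia_holds F
  haveI : CompactSpace (absInertia F) := isCompact_iff_compactSpace.mp hIcl.isCompact
  set ρI : ContinuousRep (absInertia F) ℤ A := ρ.restrict (subgroupIncl (absInertia F)) with hρI
  have hB : (Nat.card (Submodule.torsionBy ℤ A (n : ℤ))).Coprime (ringChar 𝓀[F]) :=
    natCard_coprime_of_nsmul_eq_zero (ringChar_residueField_prime (F := F)) hn fun b =>
      Subtype.ext (by
        rw [AddSubmonoidClass.coe_nsmul, ZeroMemClass.coe_zero]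
        exact (ContinuousRep.mem_torsionBy_nsmul_iff n).1 b.2)
  have hfinite := (natCard_continuousCohomology_one_absInertia_le F (ρ.torsionRep n) hB).1
  have hrep : (ρ.torsionRep n).restrict (subgroupIncl (absInertia F)) = ρI.torsionRep n := rfl
  rw [hrep] at hfinite
  haveI := hfinite
  let g : ρI.toTopRep ⟶ ρI.toTopRep :=
    TopRep.ofHom
      { toLinearMap :=
          { toFun := fun a => n • a
            map_add' := fun a b => nsmul_add a b n
            map_smul' := fun c a => by
              change n • (c • a) = c • (n • a)
              exact smul_comm n c a }
        cont := continuous_of_discreteTopology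
        isIntertwining' := fun σ => by
          refine ContinuousLinearMap.ext fun a => ?_
          change n • ρI.toTopRep.ρ σ a = ρI σ (n • a)
          rw [ContinuousRep.toTopRep_ρ_apply, map_nsmul] }
  have hg : ∀ a : A, g.hom a = n • a := fun _ => rfl
  have hSES : IsSES (ρI.torsionIncl n) g :=
    { comp_eq_zero := by
        ext a
        change n • ((a : Submodule.torsionBy ℤ A (n : ℤ)) : A) = 0
        exact (ContinuousRep.mem_torsionBy_nsmul_iff n).1 a.2
      injective := Subtype.val_injective
      exact_mid := fun y hy => ⟨⟨y, (ContinuousRep.mem_torsionBy_nsmul_iff n).2 hy⟩, rfl⟩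
      surjective := fun a => hdiv a }
  have himage : ∀ x : Submodule.torsionBy ℤ (continuousCohomology 1 ρI.toTopRep) (n : ℤ),
      ∃ y : continuousCohomology 1 (ρI.torsionRep n).toTopRep,
        cohomologyMap (ρI.torsionIncl n) 1 y = (x : continuousCohomology 1 ρI.toTopRep) := by
    intro x
    refine hSES.exists_map_one_eq_of_map_one_eq_zero _ ?_
    rw [cohomologyMap_one_eq_nsmul ρI g n hg]
    have := x.2
    rw [Submodule.mem_torsionBy_iff, Nat.cast_smul_eq_nsmul] at this
    exact this
  choose lift hlift using himage
  have hinj : Injective lift := fun x y hxy => by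
    apply Subtype.ext
    rw [← hlift x, ← hlift y, hxy]
  exact Finite.of_injective lift hinj

end Local

end Literature.NumberTheory.GaloisRepresentations

end
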